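import Literature.NumberTheory.LFunctions.ZetaGapRecordsRH
import HarnessLib

/-!
# The Montgomery–Odlyzko method cannot find gaps below `0.5042` of the mean spacing
# (Goldston–Trudgian–Turnage-Butterbaugh 2023, Theorem 1), with the method's criterion as restated there

Topic `Literature/NumberTheory/LFunctions` (namespace `Literature.NumberTheory.LFunctions`; the
paper's functional `h(c)`, the resonator norm and the resonator length `y = T^{1−δ}` live in the
sub-namespace `GoldstonTrudgianTurnageButterbaugh2023`). STATEMENT LAYER for the LANDAU–SIEGEL
programme, sub-cell §C (harvest row r2-T07 / lens «nearmiss»: a QUANTIFIED NO-GO for one design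
family of the zero-spacing lever E*-ℓ). Two NAMED FACTS (D-0014, `def … : Prop`, nothing asserted):

* `montgomeryOdlyzko1984_criterion` — the positive side of the method, AS RESTATED by
  Goldston–Trudgian–Turnage-Butterbaugh (2023) §1: on RH, if `h(c) > 1` for all sufficiently large
  `T` for some choice of coefficients, some `c` and a small `δ`, then `μ ≤ c`;
* `goldstonTrudgianTurnageButterbaugh2023_theorem1` — "**Theorem 1.** If `c < 0.5042`, then
  `h(c) < 1`" (for every choice of coefficients);

plus PROVED bookkeeping: the `c < ½` case (Conrey–Ghosh–Gonek 1984, (CGG.5) of the paper, recovered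
in its §2 Case 1) is a corollary of Theorem 1; and the no-go reading used by the programme — modulo
Theorem 1, NO family of resonators of length `⌊T^{1−δ}⌋` (coefficients may depend on `T`) satisfies
the hypothesis of the criterion at any `c < 0.5042`.

## What the source prints (held text `paper:arxiv-2201.10676` = J. Math. Anal. Appl. 527 (2023)
127548, corpus-tex, 8 chunks, read 2026-08-26; S2 lists the preprint under the title «A limitation
on proving the existence of small gaps between zeta-zeros»)

§1 (chunk p0003:L19–36): "Define, for `T ≥ 2`, `c > 0`, and `a_k` a sequence of complex numbers,
`h(c) = c − Re Σ_{kn ≤ y} a_k ā_{kn} g(n) Λ(n) n^{−1/2} / Σ_{k ≤ y} |a_k|²`, where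
`g(n) = 2 sin(πc log n/log T)/(π log n)`, and `y = T^{1−δ}` for some small `δ > 0`. Montgomery and
Odlyzko proved that if `h(c) > 1` for all sufficiently large `T` for some choice of `a_k`'s, `c`, and
a small `δ`, then assuming RH we have `μ ≤ c`. For large gaps, if we have `h(c) < 1` then `λ ≥ c`.
Conrey, Ghosh, and Gonek [CGG] showed that, for any choice of `a_k`, `h(c) < 1` if `c < 1/2`, which
shows that the Montgomery–Odlyzko method is unable to obtain `μ < 1/2`. Due to the connection to
Landau–Siegel zeros, it is a tantalizing hope that we might nevertheless reach this barrier. We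
prove, however, that the Montgomery–Odlyzko method falls well short of being able to prove
`μ ≤ 1/2`. Thus a new idea is needed to make further progress on this problem.
**Theorem 1.** If `c < 0.5042`, then `h(c) < 1`."
§2 (p0004–p0005): the proof bounds `h(c) ≤ c + max_{1 ≤ w ≤ y} G(w) + O(1/log T)` with an
ABSOLUTE implied constant (uniform in the coefficients: the error comes from
`H(x) = ∫₁ˣ g(u)u^{−1} du + O(log² x/(log T)³)`, `x = y/k ≤ T`, and `S₂ ≤ (2c/log T) Σ|b_k|²k^{−1} log k`),
and "In performing computations `δ` can be taken arbitrarily smaller than the accuracy … we can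
take `δ = 0` and thus `y = T` … we find `c₀ = 0.5042`, `β₀ = 0.476`, … and `h(c₀) ≤ 0.999993501…`"
(p0005:L1). Case 1 of §2 (`β ≥ α`) "recovers (CGG.5)", i.e. `h(c) ≤ 2c`.

## Lean rendering / design choices

* THE BILINEAR FORM IS THE TREE'S `InoueKobayashiToma2025.moForm` (ZetaGapRecordsRH.lean), not a new
  object: with `h = 2πc/log T` one has `(2/π)·Λ(n)/(√n log n)·sin((h/2) log n) = g(n)Λ(n)n^{−1/2}`
  term by term, and `moForm a L h = (2/π) Σ_{n' ≤ L} Σ_{k' ∣ n'} (…)(k') a(n'/k') conj(a(n'))` is the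
  printed `Σ_{kn ≤ y} a_k ā_{kn} g(n)Λ(n)n^{−1/2}` with `n' = kn`, `k' = n` (the `k' = 1` term
  vanishes as `Λ(1) = 0`). Hence `h(c) = c − Re(moForm a ⌊y⌋ (2πc/log T)) / Σ_{k ≤ y}|a_k|²`
  (`moFunctional`), the resonator norm is `coeffNormSq`, and `y = T^{1−δ}` enters as the natural
  number `⌊T^{1−δ}⌋₊` (`resonatorLength`; `kn ≤ y ⇔ kn ≤ ⌊y⌋` for integers).
* "for some small `δ > 0`": both facts are stated for EVERY `δ ∈ (0, 1)`. For Theorem 1 this is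
  what the printed proof gives (it uses only `y ≤ T`, and the bound `c + max G` is monotone in `y`
  and in `c`); for the criterion it is the reading of the sentence as printed.
* Uniformity in Theorem 1: `∀ δ c, … → ∃ T₀, ∀ T ≥ T₀, ∀ a` — one `T₀` serving all coefficient
  sequences, as the printed error term is absolute; the non-degeneracy `Σ_{k ≤ y}|a_k|² > 0` is the
  paper's tacit "`a_k` not all zero" (for `a = 0` the quotient is `0/0 = 0` in Lean and `h(c) = c`,
  harmless but kept out of the statement).
* The criterion's coefficients MAY depend on `T` (`a : ℝ → ℕ → ℂ`), as in every application
  (`a_k = f(log k/log y) k^{−1/2}` with `y = T^{1−δ}`); its conclusion `μ ≤ c` is the tree's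
  `ZetaGapLiminfLe c` (ZetaGapRecordsRH.lean; `μ = zetaGapLiminf`). The fact is typed AS RESTATED by
  GTTB 2023 (and re-proved in Conrey–Ghosh–Gonek 1984); Montgomery–Odlyzko's own text (Colloq. Math.
  Soc. János Bolyai 34 (1984) 1079–1106) is not held — both are cited.
* `0.5042` is the printed theorem; the sharper `0.508` of Inoue–Kobayashi–Toma (2025) is a numerical
  REMARK after their Theorem 3 (`inoueKobayashiToma2025_theorem3`, typed in ZetaGapRecordsRH.lean) and
  is deliberately not typed (there: "recorded in the cell's GAP-LEDGER, not typed").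

WHAT THIS IS NOT: no claim about the actual gaps between zeta zeros, about RH, or about Siegel
zeros; nothing here is RH-bearing except that RH is a HYPOTHESIS inside the criterion. The no-go
concerns ONE method (resonators of length `≤ T^{1−δ}` in the Montgomery–Odlyzko window count); it
says nothing about long resonators (Bondarenko–Heap 2026, `SiegelZerosSmallZetaGaps.lean`) or other
functionals (Inoue 2026).

## References

* [GoldstonTrudgianTurnageButterbaugh2023] D. A. Goldston, T. S. Trudgian, C. L. Turnage-Butterbaugh,
  *On the Montgomery–Odlyzko method regarding gaps between zeros of the zeta-function*, J. Math.
  Anal. Appl. 527 (2023) 127548 = arXiv:2201.10676, §1 and Theorem 1, §2.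
* [MontgomeryOdlyzko1984] H. L. Montgomery, A. M. Odlyzko, *Gaps between zeros of the zeta function*,
  Colloq. Math. Soc. János Bolyai 34 (1984) 1079–1106 (the criterion; cited through GTTB's §1).
* [ConreyGhoshGonek1984] J. B. Conrey, A. Ghosh, S. M. Gonek, Bull. London Math. Soc. 16 (1984)
  421–424 (the `c < 1/2` limitation (CGG.5), as recovered in GTTB §2 Case 1).
* [InoueKobayashiToma2025] for `moForm` (tree).
-/

noncomputable section

open Real

namespace Literature.NumberTheory.LFunctions

namespace GoldstonTrudgianTurnageButterbaugh2023

/-- **The resonator norm `Σ_{k ≤ L} |a_k|²`** (denominator of `h(c)`).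
[cite: GoldstonTrudgianTurnageButterbaugh2023, §1 (definition of h(c))] -/
def coeffNormSq (a : ℕ → ℂ) (L : ℕ) : ℝ :=
  ∑ k ∈ Finset.Icc 1 L, ‖a k‖ ^ 2

/-- **The resonator length `y = T^{1−δ}`**, as the integer `⌊T^{1−δ}⌋` (the printed sums run over
integers `kn ≤ y`, `k ≤ y`). [cite: GoldstonTrudgianTurnageButterbaugh2023, §1 (y = T^{1−δ})] -/
def resonatorLength (δ T : ℝ) : ℕ :=
  ⌊T ^ (1 - δ)⌋₊

/-- **The Montgomery–Odlyzko functional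
`h(c) = c − Re Σ_{kn ≤ y} a_k ā_{kn} g(n)Λ(n)n^{−1/2} / Σ_{k ≤ y}|a_k|²`**,
`g(n) = 2 sin(πc log n/log T)/(π log n)`, written with the tree's bilinear form
`InoueKobayashiToma2025.moForm a L h` at `h = 2πc/log T` and resonator length `L = ⌊y⌋`
(term-by-term identity, see the module docstring). For `a` vanishing on `[1, L]` the quotient is
Lean's `0/0 = 0` and the value is `c`. [cite: GoldstonTrudgianTurnageButterbaugh2023, §1 (definition of h(c))] -/
def moFunctional (c : ℝ) (a : ℕ → ℂ) (L : ℕ) (T : ℝ) : ℝ :=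
  c - (InoueKobayashiToma2025.moForm a L (2 * π * c / Real.log T)).re / coeffNormSq a L

/-- The resonator norm is non-negative. [cite: GoldstonTrudgianTurnageButterbaugh2023, §1 (definition of h(c))] -/
theorem coeffNormSq_nonneg (a : ℕ → ℂ) (L : ℕ) : 0 ≤ coeffNormSq a L :=
  Finset.sum_nonneg fun _ _ => by positivity

/-- For the zero resonator the functional is `c` itself (the bilinear form vanishes; documents the
junk value of the quotient). [cite: GoldstonTrudgianTurnageButterbaugh2023, §1 (definition of h(c))] -/
theorem moFunctional_zero (c : ℝ) (L : ℕ) (T : ℝ) : moFunctional c (fun _ => 0) L T = c := by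
  simp [moFunctional, InoueKobayashiToma2025.moForm]

end GoldstonTrudgianTurnageButterbaugh2023

open GoldstonTrudgianTurnageButterbaugh2023

/-! ### The named facts -/

/-- **The Montgomery–Odlyzko criterion (1984), as restated by Goldston–Trudgian–Turnage-Butterbaugh
(2023), §1**: "Montgomery and Odlyzko proved that if `h(c) > 1` for all sufficiently large `T` for
some choice of `a_k`'s, `c`, and a small `δ`, then assuming RH we have `μ ≤ c`" (resonator length
`y = T^{1−δ}`). Rendered: under `RiemannHypothesis`, for every `δ ∈ (0,1)` and `c > 0`, if SOME
family of coefficient sequences `a_T` (allowed to depend on `T`) has `Σ_{k ≤ y}|a_{T,k}|² > 0` and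
`h(c) > 1` for all `T ≥ T₀`, then `μ ≤ c` (the tree's `ZetaGapLiminfLe c`). NAMED FACT, not proved
here; typed from the secondary restatement (the 1984 original is not held), re-proved in
Conrey–Ghosh–Gonek (1984).
[cite: MontgomeryOdlyzko1984, main theorem (as restated in GoldstonTrudgianTurnageButterbaugh2023 §1, p. 2)] -/
def montgomeryOdlyzko1984_criterion : Prop :=
  RiemannHypothesis →
    ∀ (δ c : ℝ), 0 < δ → δ < 1 → 0 < c →
      ∀ a : ℝ → ℕ → ℂ,
        (∃ T₀ : ℝ, ∀ T : ℝ, T₀ ≤ T →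
            0 < coeffNormSq (a T) (resonatorLength δ T) ∧
              1 < moFunctional c (a T) (resonatorLength δ T) T) →
          ZetaGapLiminfLe c

/-- **Goldston–Trudgian–Turnage-Butterbaugh 2023, Theorem 1.** "If `c < 0.5042`, then `h(c) < 1`"
— for ANY choice of the coefficients `a_k` (abstract: "this method can never find infinitely many
pairs of consecutive zeros within `0.5042` times the average spacing"; proof: `h(c) ≤ c + max_w G(w) +
O(1/log T)` with an absolute implied constant and `c₀ + G ≤ 0.999993501…` at `c₀ = 0.5042`).
Rendered: for every `δ ∈ (0,1)` and `0 < c < 0.5042` there is `T₀` such that for all `T ≥ T₀` and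
every coefficient sequence not identically zero on `[1, ⌊T^{1−δ}⌋]`, `h(c) < 1`. UNCONDITIONAL (no RH).
NAMED FACT, not proved here. [cite: GoldstonTrudgianTurnageButterbaugh2023, Theorem 1 (p. 2; proof §2, numerics p. 4)] -/
def goldstonTrudgianTurnageButterbaugh2023_theorem1 : Prop :=
  ∀ (δ c : ℝ), 0 < δ → δ < 1 → 0 < c → c < 0.5042 →
    ∃ T₀ : ℝ, ∀ T : ℝ, T₀ ≤ T → ∀ a : ℕ → ℂ,
      0 < coeffNormSq a (resonatorLength δ T) →
        moFunctional c a (resonatorLength δ T) T < 1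

/-! ### Bookkeeping (proved) -/

/-- **The `c < ½` limitation of Conrey–Ghosh–Gonek (1984)** ("for any choice of `a_k`, `h(c) < 1`
if `c < 1/2`", (CGG.5) of GTTB 2023, recovered in their §2 Case 1) is, in the rendered form, a
corollary of Theorem 1 (`1/2 < 0.5042`). PROVED modulo the fact.
[cite: GoldstonTrudgianTurnageButterbaugh2023, §1 eq. (CGG.5) and §2 Case 1] -/
theorem moFunctional_lt_one_of_lt_half (h : goldstonTrudgianTurnageButterbaugh2023_theorem1)
    {δ c : ℝ} (hδ : 0 < δ) (hδ1 : δ < 1) (hc : 0 < c) (hc2 : c < 1 / 2) :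
    ∃ T₀ : ℝ, ∀ T : ℝ, T₀ ≤ T → ∀ a : ℕ → ℂ,
      0 < coeffNormSq a (resonatorLength δ T) →
        moFunctional c a (resonatorLength δ T) T < 1 :=
  h δ c hδ hδ1 hc (by linarith)

/-- **The no-go reading (what the programme uses).** Modulo Theorem 1: for `c < 0.5042` and any
`δ ∈ (0,1)`, NO family of resonators `a_T` of length `⌊T^{1−δ}⌋` (coefficients may depend on `T`)
satisfies the hypothesis of the Montgomery–Odlyzko criterion — "`h(c) > 1` for all sufficiently
large `T`" is impossible. PROVED. [cite: GoldstonTrudgianTurnageButterbaugh2023, Theorem 1 and §1 ("falls well short of being able to prove μ ≤ 1/2")] -/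
theorem no_moCriterion_below (h : goldstonTrudgianTurnageButterbaugh2023_theorem1)
    {δ c : ℝ} (hδ : 0 < δ) (hδ1 : δ < 1) (hc : 0 < c) (hc2 : c < 0.5042) (a : ℝ → ℕ → ℂ) :
    ¬ ∃ T₀ : ℝ, ∀ T : ℝ, T₀ ≤ T →
        0 < coeffNormSq (a T) (resonatorLength δ T) ∧
          1 < moFunctional c (a T) (resonatorLength δ T) T := by
  rintro ⟨T₀, hT₀⟩
  obtain ⟨T₁, hT₁⟩ := h δ c hδ hδ1 hc hc2
  obtain ⟨hpos, hgt⟩ := hT₀ (max T₀ T₁) (le_max_left _ _)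
  have hlt := hT₁ (max T₀ T₁) (le_max_right _ _) (a (max T₀ T₁)) hpos
  linarith

/-- **Corollary for the criterion.** Modulo Theorem 1, the Montgomery–Odlyzko criterion (as typed)
can only ever be APPLIED with `c ≥ 0.5042`: if its hypothesis holds for some `δ ∈ (0,1)`, `c > 0`
and some family of coefficients, then `0.5042 ≤ c`. PROVED.
[cite: GoldstonTrudgianTurnageButterbaugh2023, Theorem 1 (abstract: "can never find … within 0.5042 times the average spacing")] -/
theorem le_of_moCriterion_hypothesis (h : goldstonTrudgianTurnageButterbaugh2023_theorem1)
    {δ c : ℝ} (hδ : 0 < δ) (hδ1 : δ < 1) (hc : 0 < c) (a : ℝ → ℕ → ℂ)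
    (hyp : ∃ T₀ : ℝ, ∀ T : ℝ, T₀ ≤ T →
        0 < coeffNormSq (a T) (resonatorLength δ T) ∧
          1 < moFunctional c (a T) (resonatorLength δ T) T) :
    (0.5042 : ℝ) ≤ c := by
  by_contra hlt
  push Not at hlt
  exact no_moCriterion_below h hδ hδ1 hc hlt a hyp

end Literature.NumberTheory.LFunctions

end
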